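import Summits.QuantumFields.YangMills.Theorems.BalabanLadderUVSeamRecColdWallComb
import Summits.QuantumFields.YangMills.Theorems.BalabanLadderUVSeamRecColdWallCube
import Summits.QuantumFields.YangMills.Theorems.BalabanLadderUVSeamRecColdWallDirichletPinning
import HarnessLib

/-!
# Crux `UVSeamRec` (stmt-QuantumFields-20043): the COLD-WALL BOX CEILING WITHOUT THE LOG —
# `kerE^{𝟙}_{β,Λ}(S_Λ) ≤ 92 · #P_Λ / β` for every cube `Λ` of `ℤ⁴` and every `β ≥ 1`, uniformly in the cube

Helper file (`--supports stmt-QuantumFields-20043`) of the LEAD seat `ym-spine-20043-p1` (gen 12).  Gen 11 (`…ColdWallBoxCeiling`) proved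
`kerE^{𝟙}_{β,Λ}(S_Λ) ≤ #P_Λ(34 + 6 log β)/β` from the chord `[0, β]` of the convex `log Z_Λ` and named the missing piece for removing the `log β`:
gauge fixing inside the cube.  This file takes the chord `[β/2, β]` instead:
* §1 **`sub_mul_gibbsMean_le_log_sub`** — on any probability space, for bounded measurable `S` and real `β, β'`:
  `(β − β')·⟨S⟩_β ≤ log Z(β') − log Z(β)` (Jensen under the tilted measure; gen 11's `mul_gibbsMean_le_neg_log` is `β' = 0`);
* §2 `log_const_le` — `log 3 + (3/2) log 2 + log 600 ≤ 19/2`;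
* §3 **`kerE_one_wilsonBoundaryAction_le_sharp`** — `SU(2)`, every cube `(c, b)`, every `β ≥ 1`:
  `kerE^{𝟙}_{β,(c,b)}(S_Λ) ≤ (2/β)·((19/2)·#(Λ ∖ T) + 8 #P_Λ) ≤ 92 #P_Λ/β` — the UPPER bound `Z_Λ(β/2; 𝟙) ≤ (3/((β/2)√(β/2)))^{#(Λ∖T)}` (complete peeling
  family of the cube, `…ColdWallComb`) against the LOWER bound `Z_Λ(β; 𝟙) ≥ e^{−8#P_Λ}(β^{−3/2}/600)^{#(Λ∖T)}` (axial gauge of the deep temporal comb,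
  `…ColdWallCube`, `r = β^{−1/2}`): the `(3/2)·#(Λ∖T)·log β` terms CANCEL EXACTLY (the cold wall has no closers and no torons), leaving `O(1)`
  per degree of freedom: the box-AVERAGE plaquette deficit of a cold-wall cube is `≤ 92/β`, UNIFORMLY IN THE CUBE — Tier 3(b) of tempered-d1's
  memo in its sharp (log-free) form;
* §4 the log-free twins of gen 11's `…ColdWallDirichletPinning`: **`kerE_one_deficit_le_pointwise_sharp`** (fixed radius:
  `kerE^{𝟙}(2 − plane q x) ≤ 120(2R+3)⁴·92/β`) and **`dirichletRate_two_sub_ref_mem_Icc_sharp`** (under line «coldwall_pure»'s (DR) with `C₁ > 0`: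
  `2 − p q β ∈ [6/(24β+3) − C₁A₀/R⁴, 11040(2R+3)⁴/β + C₁A₀/R⁴]` for every admissible `R` — both ends now `Θ_R(1/β)`).
The POINTWISE centre ceiling uniform in `R` (Tier 3) is NOT claimed (no mechanism; technology class of `stub_coldWallSplit`).
HONEST FRAMING: an elementary two-sided Laplace estimate of one Dirichlet cube free energy; nothing of E0′, NT or the gap; not Clay.
-/

open MeasureTheory Finset
open scoped ENNReal Matrix Matrix.Norms.Frobenius
open Literature.MathematicalPhysics.QuantumFieldTheory (haarProbability LatticeRep)
open Literature.MathematicalPhysics.QuantumLattice (fundamentalLatticeRep fundamentalRep fundamentalRep_mem_unitaryGroup continuous_fundamentalRep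
  secondCountableTopology_su2 LGConfig ZdEdge plaquettesTouching wilsonBoundaryAction integral_ymSpecification continuous_wilsonBoundaryAction
  continuous_glueWith_prod)
open Literature.Probability.LatticeModels (glueWith)
open Summit.QuantumFields.YangMills.Cruxes.OSLegsFromFemtoAndGap.DlrCollarTransfer

noncomputable section

namespace Summit.QuantumFields.YangMills.Cruxes.UVSeamRec.ClassicalResponse.ColdWall

/-! ### §1 The chord of the convex log-partition function -/

/-- **The chord inequality.**  On a probability space, for a bounded measurable `S` and real `β, β'`:
`(β − β') · ⟨S⟩_β ≤ log Z(β') − log Z(β)`, where `Z(b) = ∫ e^{−bS} dπ` and `⟨S⟩_β = ∫ S e^{−βS} dπ / Z(β)` — Jensen's inequality for `exp` under the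
tilted probability measure `π.tilted(−βS)`: `Z(β')/Z(β) = ∫ e^{(β−β')S} d(tilted) ≥ exp((β−β')⟨S⟩_β)`. [cite: FriedliVelenik2017, Lemma 3.5 (p. 94), App. B.8.1] -/
theorem sub_mul_gibbsMean_le_log_sub {Ω : Type*} [MeasurableSpace Ω] (π : Measure Ω) [IsProbabilityMeasure π] {S : Ω → ℝ}
    (hS : Measurable S) {C : ℝ} (hSb : ∀ ω, |S ω| ≤ C) (β β' : ℝ) :
    (β - β') * ((∫ ω, S ω * Real.exp (-β * S ω) ∂π) / ∫ ω, Real.exp (-β * S ω) ∂π) ≤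
      Real.log (∫ ω, Real.exp (-β' * S ω) ∂π) - Real.log (∫ ω, Real.exp (-β * S ω) ∂π) := by
  -- bounded exponential integrands
  have hexp_int : ∀ b : ℝ, Integrable (fun ω => Real.exp (-b * S ω)) π := fun b =>
    Integrable.of_bound (Real.measurable_exp.comp (hS.const_mul _)).aestronglyMeasurable (Real.exp (|b| * C))
      (ae_of_all _ fun ω => by
        rw [Real.norm_eq_abs, Real.abs_exp]
        refine Real.exp_le_exp.2 ((le_abs_self _).trans ?_)
        rw [abs_mul, abs_neg]; gcongr; exact hSb ω)
  set f : Ω → ℝ := fun ω => -β * S ω with hf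
  have hfint : Integrable (fun ω => Real.exp (f ω)) π := hexp_int β
  set Z : ℝ := ∫ ω, Real.exp (f ω) ∂π with hZ
  have hZpos : 0 < Z := by rw [hZ]; exact integral_exp_pos hfint
  set Z' : ℝ := ∫ ω, Real.exp (-β' * S ω) ∂π with hZ'
  have hZ'pos : 0 < Z' := by rw [hZ']; exact integral_exp_pos (hexp_int β')
  set ν : Measure Ω := π.tilted f with hν
  haveI : IsProbabilityMeasure ν := isProbabilityMeasure_tilted hfint
  -- Jensen under `ν` for `g = (β − β') S`
  have hg_int : Integrable (fun ω => (β - β') * S ω) ν :=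
    Integrable.of_bound (hS.const_mul _).aestronglyMeasurable (|β - β'| * C)
      (ae_of_all _ fun ω => by rw [Real.norm_eq_abs, abs_mul]; gcongr; exact hSb ω)
  have heg_int : Integrable (fun ω => Real.exp ((β - β') * S ω)) ν :=
    Integrable.of_bound (Real.measurable_exp.comp (hS.const_mul _)).aestronglyMeasurable (Real.exp (|β - β'| * C))
      (ae_of_all _ fun ω => by
        rw [Real.norm_eq_abs, Real.abs_exp]
        refine Real.exp_le_exp.2 ((le_abs_self _).trans ?_)
        rw [abs_mul]; gcongr; exact hSb ω)
  have hJ := (convexOn_exp.map_integral_le Real.continuous_exp.continuousOn isClosed_univ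
    (ae_of_all _ fun _ => Set.mem_univ _) hg_int heg_int)
  -- `∫ exp((β−β')S) dν = Z'/Z`
  have h1 : ∫ ω, Real.exp ((β - β') * S ω) ∂ν = Z' / Z := by
    have h := integral_exp_tilted (μ := π) f (fun ω => (β - β') * S ω)
    rw [hν, h]
    have : (f + fun ω => (β - β') * S ω) = fun ω => -β' * S ω := by funext ω; simp only [hf, Pi.add_apply]; ring
    rw [this, ← hZ, ← hZ']
  -- `∫ (β−β')S dν = (β−β') ⟨S⟩_β`
  have h2 : ∫ ω, (β - β') * S ω ∂ν = (β - β') * ((∫ ω, S ω * Real.exp (-β * S ω) ∂π) / Z) := by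
    rw [hν, integral_tilted]
    simp_rw [smul_eq_mul]
    have : ∀ ω, Real.exp (f ω) / (∫ x, Real.exp (f x) ∂π) * ((β - β') * S ω) =
        ((β - β') / ∫ x, Real.exp (f x) ∂π) * (S ω * Real.exp (-β * S ω)) := by
      intro ω
      have he : Real.exp (f ω) = Real.exp (-β * S ω) := by rw [hf]
      rw [he]; ring
    simp_rw [this]
    rw [integral_const_mul, ← hZ]
    ring
  rw [h1, h2] at hJ
  have h3 : Real.exp ((β - β') * ((∫ ω, S ω * Real.exp (-β * S ω) ∂π) / Z)) ≤ Z' / Z := hJ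
  have h4 := Real.log_le_log (Real.exp_pos _) h3
  rw [Real.log_exp, Real.log_div hZ'pos.ne' hZpos.ne'] at h4
  exact h4

/-! ### §2 A numerical constant -/

/-- `log 3 + (3/2) log 2 + log 600 ≤ 19/2` (`3 < 4 = 2²`, `600 < 1024 = 2¹⁰`, `log 2 < 0.6931471808`). [folklore] -/
theorem log_const_le : Real.log 3 + 3 / 2 * Real.log 2 + Real.log 600 ≤ 19 / 2 := by
  have h2 := Real.log_two_lt_d9
  have h2pos : 0 < Real.log 2 := Real.log_pos (by norm_num)
  have h3 : Real.log 3 ≤ 2 * Real.log 2 := by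
    rw [← Real.log_rpow (by norm_num : (0 : ℝ) < 2)]
    exact Real.log_le_log (by norm_num) (by norm_num)
  have h600 : Real.log 600 ≤ 10 * Real.log 2 := by
    rw [← Real.log_rpow (by norm_num : (0 : ℝ) < 2)]
    exact Real.log_le_log (by norm_num) (by norm_num)
  nlinarith

/-! ### §3 The cold-wall box ceiling without the log -/

/-- **THE COLD-WALL BOX CEILING WITHOUT THE LOG (`SU(2)`, crux letters).**  For the defining representation of `SU(2)` (tree units `β = β_W/2`), every
cube `(c, b)` of `ℤ⁴` (`Λ = cubeEdges c b`, identity exterior, deep temporal comb `T`) and every `β ≥ 1`: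
`kerE^{𝟙}_{β,(c,b)}(S_Λ) ≤ (2/β)·((19/2)·#(Λ ∖ T) + 8·#P_Λ)` — chord `[β/2, β]` of the convex `log Z_Λ(·; 𝟙)`, the complete-peeling upper bound at `β/2`
and the gauge-fixed lower bound at `β` (`r = β^{−1/2}`, small ball `r³/600`); the `(3/2)#(Λ∖T) log β` terms cancel. [folklore] -/
theorem kerE_one_wilsonBoundaryAction_le_sharp' (c : Fin 4 → ℤ) (b : ℕ) {β : ℝ} (hβ : 1 ≤ β) :
    kerE (Matrix.specialUnitaryGroup (Fin 2) ℂ) (fundamentalLatticeRep 2) β c b (fun _ => 1)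
        (wilsonBoundaryAction (fundamentalRep (Fin 2)) (cubeEdges c b)) ≤
      (2 / β) * (19 / 2 * ((cubeEdges c b \ (cubeEdges c b).filter (fun ℓ => ℓ.2 = 3 ∧
          ∀ j, c j + 1 ≤ (ℓ.1 + Pi.single 3 1 : Fin 4 → ℤ) j ∧ (ℓ.1 + Pi.single 3 1 : Fin 4 → ℤ) j + 2 ≤ c j + b)).card : ℝ) +
        8 * (plaquettesTouching (cubeEdges c b)).card) := by
  haveI : SecondCountableTopology (Matrix.specialUnitaryGroup (Fin 2) ℂ) := secondCountableTopology_su2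
  set Λ := cubeEdges c b with hΛ
  set m : ℕ := (cubeEdges c b \ (cubeEdges c b).filter (fun ℓ => ℓ.2 = 3 ∧
      ∀ j, c j + 1 ≤ (ℓ.1 + Pi.single 3 1 : Fin 4 → ℤ) j ∧ (ℓ.1 + Pi.single 3 1 : Fin 4 → ℤ) j + 2 ≤ c j + b)).card with hm
  set P : ℝ := ((plaquettesTouching (cubeEdges c b)).card : ℝ) with hP
  have hβ0 : 0 < β := by linarith
  set π₀ : Measure (↥Λ → Matrix.specialUnitaryGroup (Fin 2) ℂ) :=
    Measure.pi fun _ : ↥Λ => haarProbability (Matrix.specialUnitaryGroup (Fin 2) ℂ) with hπ₀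
  haveI hprob : IsProbabilityMeasure (haarProbability (Matrix.specialUnitaryGroup (Fin 2) ℂ)) :=
    ⟨by simpa [haarProbability] using Measure.haarMeasure_self (G := Matrix.specialUnitaryGroup (Fin 2) ℂ) (K₀ := ⊤)⟩
  haveI : IsProbabilityMeasure π₀ := by rw [hπ₀]; infer_instance
  set η₁ : LGConfig 4 (Matrix.specialUnitaryGroup (Fin 2) ℂ) := fun _ => 1 with hη₁
  set S : (↥Λ → Matrix.specialUnitaryGroup (Fin 2) ℂ) → ℝ := fun ζ => wilsonBoundaryAction (fundamentalRep (Fin 2)) Λ (glueWith Λ ζ η₁)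
    with hSdef
  have hSc : Continuous S := (continuous_wilsonBoundaryAction _ (continuous_fundamentalRep (Fin 2)) Λ).comp
    ((continuous_glueWith_prod Λ).comp (Continuous.prodMk_right η₁))
  obtain ⟨C, hC⟩ : ∃ C, ∀ ζ, |S ζ| ≤ C := by
    obtain ⟨ζ₀, -, hζ₀⟩ := isCompact_univ.exists_isMaxOn Set.univ_nonempty (continuous_abs.comp hSc).continuousOn
    exact ⟨|S ζ₀|, fun ζ => hζ₀ (Set.mem_univ ζ)⟩
  -- the kernel mean is the Gibbs mean on the fibre
  have hρ : (fundamentalLatticeRep 2).ρ = fundamentalRep (Fin 2) := rfl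
  unfold kerE
  rw [hρ, ← hΛ]
  refine (integral_ymSpecification (fundamentalRep (Fin 2)) (continuous_fundamentalRep (Fin 2)) β Λ
    (continuous_wilsonBoundaryAction _ (continuous_fundamentalRep (Fin 2)) Λ).measurable η₁).trans_le ?_
  change (∫ ζ, S ζ * Real.exp (-β * S ζ) ∂π₀) / (∫ ζ, Real.exp (-β * S ζ) ∂π₀) ≤ _
  -- the chord `[β/2, β]`
  have hchord := sub_mul_gibbsMean_le_log_sub π₀ hSc.measurable hC β (β / 2)
  -- the upper bound at `β/2`
  have hb2 : 0 < β / 2 := by linarith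
  have hup : ∫ ζ, Real.exp (-(β / 2) * S ζ) ∂π₀ ≤ (3 / (β / 2 * Real.sqrt (β / 2))) ^ m :=
    fibreIntegral_exp_neg_mul_cube_le_su2 c b η₁ hb2
  -- the lower bound at `β`, `r = β^{−1/2}`
  set r : ℝ := Real.sqrt (1 / β) with hr
  have hr0 : 0 < r := Real.sqrt_pos.2 (by positivity)
  have hr2 : r ^ 2 = 1 / β := by rw [hr, Real.sq_sqrt (by positivity)]
  have hr1 : r ≤ 1 := by rw [hr, Real.sqrt_le_left zero_le_one, one_pow, div_le_one hβ0]; exact hβ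
  have hφ := ThermalFloor.haarProbability_real_frobeniusBall_ge_su2_sharp hr0 hr1
  have hlow := fibreIntegral_exp_neg_mul_one_cube_ge (fundamentalRep (Fin 2)) (continuous_fundamentalRep (Fin 2))
    fundamentalRep_mem_unitaryGroup c b hβ0.le hr0
  set φ : ℝ := (haarProbability (Matrix.specialUnitaryGroup (Fin 2) ℂ)).real
    {g : Matrix.specialUnitaryGroup (Fin 2) ℂ | ‖fundamentalRep (Fin 2) g - 1‖ ≤ r} with hφdef
  have hφpos : 0 < φ := lt_of_lt_of_le (by positivity) hφ
  -- positivity of the partition functions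
  have hZpos : 0 < ∫ ζ, Real.exp (-β * S ζ) ∂π₀ := lt_of_lt_of_le (by positivity) hlow
  have hZ2pos : 0 < ∫ ζ, Real.exp (-(β / 2) * S ζ) ∂π₀ := by
    have hint : Integrable (fun ζ => Real.exp (-(β / 2) * S ζ)) π₀ :=
      Integrable.of_bound (Real.measurable_exp.comp (hSc.measurable.const_mul _)).aestronglyMeasurable (Real.exp (|β / 2| * C))
        (ae_of_all _ fun ζ => by
          rw [Real.norm_eq_abs, Real.abs_exp]
          refine Real.exp_le_exp.2 ((le_abs_self _).trans ?_)
          rw [abs_mul, abs_neg]; gcongr; exact hC ζ)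
    exact integral_exp_pos hint
  -- logarithms
  have hlogup : Real.log (∫ ζ, Real.exp (-(β / 2) * S ζ) ∂π₀) ≤ m * (Real.log 3 - 3 / 2 * (Real.log β - Real.log 2)) := by
    have h := Real.log_le_log hZ2pos hup
    have hbase : 0 < 3 / (β / 2 * Real.sqrt (β / 2)) := by positivity
    rw [Real.log_pow, Real.log_div (by norm_num) (by positivity), Real.log_mul hb2.ne' (Real.sqrt_pos.2 hb2).ne',
      Real.log_sqrt hb2.le, Real.log_div hβ0.ne' (by norm_num)] at h
    have e : Real.log 3 - (Real.log β - Real.log 2 + (Real.log β - Real.log 2) / 2) =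
        Real.log 3 - 3 / 2 * (Real.log β - Real.log 2) := by ring
    rw [e] at h
    exact h
  have hloglow : -(8 * P) + m * (-(3 / 2) * Real.log β - Real.log 600) ≤ Real.log (∫ ζ, Real.exp (-β * S ζ) ∂π₀) := by
    have h := Real.log_le_log (mul_pos (Real.exp_pos _) (pow_pos hφpos _)) hlow
    rw [Real.log_mul (Real.exp_pos _).ne' (pow_pos hφpos _).ne', Real.log_exp, Real.log_pow, hr2] at h
    have hlogφ : 3 * Real.log r - Real.log 600 ≤ Real.log φ := by
      have h1 := Real.log_le_log (by positivity) hφ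
      rw [Real.log_div (by positivity) (by norm_num), Real.log_pow] at h1
      push_cast at h1
      exact h1
    have hlogr : Real.log r = -(Real.log β) / 2 := by
      rw [hr, Real.log_sqrt (by positivity), one_div, Real.log_inv]
    rw [hlogr] at hlogφ
    have hm0 : (0 : ℝ) ≤ m := Nat.cast_nonneg _
    have hβne : β ≠ 0 := hβ0.ne'
    have e1 : -(8 * β * (1 / β) * P) = -(8 * P) := by field_simp
    rw [e1] at h
    nlinarith [mul_le_mul_of_nonneg_left hlogφ hm0]
  -- assemble
  have hkey : (β - β / 2) * ((∫ ζ, S ζ * Real.exp (-β * S ζ) ∂π₀) / ∫ ζ, Real.exp (-β * S ζ) ∂π₀) ≤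
      m * (Real.log 3 + 3 / 2 * Real.log 2 + Real.log 600) + 8 * P := by
    refine hchord.trans ?_
    nlinarith
  have hlc := log_const_le
  have hm0 : (0 : ℝ) ≤ m := Nat.cast_nonneg _
  have hmean : (β / 2) * ((∫ ζ, S ζ * Real.exp (-β * S ζ) ∂π₀) / ∫ ζ, Real.exp (-β * S ζ) ∂π₀) ≤ 19 / 2 * m + 8 * P := by
    have e : β - β / 2 = β / 2 := by ring
    rw [e] at hkey
    nlinarith [mul_le_mul_of_nonneg_left hlc hm0]
  have hβne : β ≠ 0 := hβ0.ne'
  rw [show (2 / β) * (19 / 2 * (m : ℝ) + 8 * P) = (19 / 2 * m + 8 * P) / (β / 2) by field_simp]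
  rw [le_div_iff₀ hb2]
  linarith

/-- **Box-average form**: for every cube `(c, b)` and `β ≥ 1`, `kerE^{𝟙}_{β,(c,b)}(S_Λ) ≤ 92 · #P_Λ / β` (`#(Λ ∖ T) ≤ #Λ ≤ 4 #P_Λ`): the AVERAGE plaquette
deficit `2 − Re tr U_p` of a cold-wall cube is `≤ 92/β`, UNIFORMLY IN THE CUBE, with NO `log β` (gen 11: `(34 + 6 log β)/β`). [folklore] -/
theorem kerE_one_wilsonBoundaryAction_le_sharp (c : Fin 4 → ℤ) (b : ℕ) {β : ℝ} (hβ : 1 ≤ β) :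
    kerE (Matrix.specialUnitaryGroup (Fin 2) ℂ) (fundamentalLatticeRep 2) β c b (fun _ => 1)
        (wilsonBoundaryAction (fundamentalRep (Fin 2)) (cubeEdges c b)) ≤
      92 * (plaquettesTouching (cubeEdges c b)).card / β := by
  have h := kerE_one_wilsonBoundaryAction_le_sharp' c b hβ
  have hβ0 : 0 < β := by linarith
  refine h.trans ?_
  have hm : ((cubeEdges c b \ (cubeEdges c b).filter (fun ℓ => ℓ.2 = 3 ∧
      ∀ j, c j + 1 ≤ (ℓ.1 + Pi.single 3 1 : Fin 4 → ℤ) j ∧ (ℓ.1 + Pi.single 3 1 : Fin 4 → ℤ) j + 2 ≤ c j + b)).card : ℝ) ≤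
      4 * (plaquettesTouching (cubeEdges c b)).card := by
    have h1 : (cubeEdges c b \ (cubeEdges c b).filter (fun ℓ => ℓ.2 = 3 ∧
        ∀ j, c j + 1 ≤ (ℓ.1 + Pi.single 3 1 : Fin 4 → ℤ) j ∧ (ℓ.1 + Pi.single 3 1 : Fin 4 → ℤ) j + 2 ≤ c j + b)).card ≤
        (cubeEdges c b).card := Finset.card_le_card Finset.sdiff_subset
    have h2 := ThermalFloor.card_le_four_mul_card_plaquettesTouching (cubeEdges c b)
    exact_mod_cast h1.trans h2
  have hP : (0 : ℝ) ≤ (plaquettesTouching (cubeEdges c b)).card := Nat.cast_nonneg _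
  rw [div_mul_eq_mul_div, div_le_div_iff_of_pos_right hβ0]
  nlinarith

/-! ### §4 Log-free twins of the fixed-radius pointwise ceiling and of the (DR) pinning -/

/-- **THE POINTWISE COLD-WALL CEILING AT FIXED RADIUS, without the log (`SU(2)`).**  For `β ≥ 1`, every radius `R`, orientation `q.1 < q.2` and site
`x`, under the cold-wall kernel of the cube `(x − R − 1, 2R+3)`: `kerE^{𝟙}_{β}(2 − plane q x) ≤ 120 (2R+3)⁴ · 92/β` (gen 11: `·(34 + 6 log β)/β`).
NOT the R-uniform Tier 3. [folklore] -/
theorem kerE_one_deficit_le_pointwise_sharp {β : ℝ} (hβ : 1 ≤ β) (R : ℕ) (q : Fin 4 × Fin 4) (hq : q.1 < q.2) (x : Fin 4 → ℤ) :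
    kerE (Matrix.specialUnitaryGroup (Fin 2) ℂ) (fundamentalLatticeRep 2) β (fun k => x k - (R + 1)) (2 * R + 3) (fun _ => 1)
        (fun U => 2 - plane (Matrix.specialUnitaryGroup (Fin 2) ℂ) (fundamentalLatticeRep 2) q x U) ≤
      120 * ((2 * R + 3 : ℕ) : ℝ) ^ 4 * (92 / β) := by
  have h1 : kerE (Matrix.specialUnitaryGroup (Fin 2) ℂ) (fundamentalLatticeRep 2) β (fun k => x k - (R + 1)) (2 * R + 3) (fun _ => 1)
        (fun U => 2 - plane (Matrix.specialUnitaryGroup (Fin 2) ℂ) (fundamentalLatticeRep 2) q x U) ≤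
      kerE (Matrix.specialUnitaryGroup (Fin 2) ℂ) (fundamentalLatticeRep 2) β (fun k => x k - (R + 1)) (2 * R + 3) (fun _ => 1)
        (wilsonBoundaryAction (fundamentalRep (Fin 2)) (cubeEdges (fun k => x k - (R + 1)) (2 * R + 3))) := by
    have h := ThermalFloor.kerE_deficit_le_kerE_wilsonBoundaryAction (Matrix.specialUnitaryGroup (Fin 2) ℂ) (fundamentalLatticeRep 2) β hq x R
      (fun _ => 1)
    have hN : ((fundamentalLatticeRep 2).N : ℝ) = 2 := by simp
    simp only [hN] at h
    exact h
  have h2 := kerE_one_wilsonBoundaryAction_le_sharp (fun k => x k - (R + 1)) (2 * R + 3) hβ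
  have h3 : ((plaquettesTouching (cubeEdges (fun k => x k - ((R : ℤ) + 1)) (2 * R + 3))).card : ℝ) ≤ 120 * ((2 * R + 3 : ℕ) : ℝ) ^ 4 := by
    have := ThermalFloor.card_plaquettesTouching_cubeEdges_le (fun k => x k - ((R : ℤ) + 1)) (2 * R + 3)
    exact_mod_cast this
  have hβ0 : 0 < β := by linarith
  have hβne : β ≠ 0 := hβ0.ne'
  refine h1.trans (h2.trans ?_)
  rw [div_le_iff₀ hβ0]
  have e : 120 * ((2 * R + 3 : ℕ) : ℝ) ^ 4 * (92 / β) * β = 92 * (120 * ((2 * R + 3 : ℕ) : ℝ) ^ 4) := by field_simp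
  rw [e]
  nlinarith

/-- **The (DR) reference is `2 − Θ_R(1/β)`, without the log.**  Under line «coldwall_pure»'s `DirichletRate C₁ A₀ β₁ ℓ₁ p` (`C₁ > 0`), for `β ≥ β₁`,
`β ≥ 1`, `1 ≤ R`, `R·uRec β ≤ ℓ₁`, `q.1 < q.2`:
`2 − p q β ∈ [6/(24β+3) − C₁A₀/R⁴, 120(2R+3)⁴·92/β + C₁A₀/R⁴]` (gen 10's floor `dirichletRate_ref_le`, the (DR) tolerance, and
`kerE_one_deficit_le_pointwise_sharp`). [folklore] -/
theorem dirichletRate_two_sub_ref_mem_Icc_sharp {C₁ A₀ β₁ ℓ₁ : ℝ} {p : Fin 4 × Fin 4 → ℝ → ℝ} (h : DirichletRate C₁ A₀ β₁ ℓ₁ p) (hC₁ : 0 < C₁)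
    {β : ℝ} (hβ₁ : β₁ ≤ β) (hβ : 1 ≤ β) {R : ℕ} (hR : 1 ≤ R) (hRu : (R : ℝ) * Transport.uRec β ≤ ℓ₁)
    (q : Fin 4 × Fin 4) (hq : q.1 < q.2) :
    2 - p q β ∈ Set.Icc (6 / (24 * β + 3) - C₁ * A₀ / (R : ℝ) ^ 4)
      (120 * ((2 * R + 3 : ℕ) : ℝ) ^ 4 * (92 / β) + C₁ * A₀ / (R : ℝ) ^ 4) := by
  have h2 := abs_sub_le_of_dirichletRate hC₁ h hβ₁ hR hRu q hq 0
  have h3 := kerE_one_deficit_le_pointwise_sharp hβ R q hq 0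
  have hone : (fun _ : ZdEdge 4 => (1 : Matrix.specialUnitaryGroup (Fin 2) ℂ)) = (1 : LGConfig 4 (Matrix.specialUnitaryGroup (Fin 2) ℂ)) := rfl
  rw [hone, kerE_const_sub (fundamentalLatticeRep 2) β _ _ 1 (continuous_plane (fundamentalLatticeRep 2) q 0)] at h3
  have h4 := (abs_le.1 h2).2
  have h5 := ThermalFloor.dirichletRate_ref_le h hC₁ hβ₁ (by linarith) hR hRu q hq
  push_cast at h3 h4 ⊢
  exact ⟨by linarith, by linarith⟩

end Summit.QuantumFields.YangMills.Cruxes.UVSeamRec.ClassicalResponse.ColdWall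

end
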